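import Literature.Topology.FourManifolds.InverseFunctionTheorem
import Mathlib.Analysis.Calculus.FDeriv.Prod
import Mathlib.Analysis.Calculus.Deriv.Prod
import Mathlib.Analysis.Calculus.Deriv.Comp
import Mathlib.Analysis.Complex.Basic
import HarnessLib

/-!
# Local diffeomorphisms from an invertible partial derivative (parametric inverse function theorem)

Infrastructure for the explicit fishtail neighbourhood of R. Gompf, *More Cappell–Shaneson
spheres are standard*, Algebr. Geom. Topol. 10 (2010), Thm 2.1 / Lemma 2.2 (the named fact
`Literature.Topology.FourManifolds.gompf2010_framedTwist`): the tubular parametrisations of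
Gompf's disc are maps of the shape `(p, x) ↦ (p, f (p, x))` — some coordinates are carried along,
the others are transformed by a map which is only implicitly invertible (interpolated normal
frames, the switch between the cap chart and the affine chart). Such a map is a local
diffeomorphism wherever the partial derivative `∂ₓ f` is invertible, by the inverse function
theorem applied to the block-triangular derivative (Lee, *Introduction to Smooth Manifolds*,
Thm. 4.5 and Thm. C.40 (implicit function theorem) for the statement; here a corollary of the
tree's `isLocalDiffeomorphAt_of_mfderiv`).

* `Literature.Topology.FourManifolds.isLocalDiffeomorphAt_of_hasFDerivAt_equiv` — a `C^n` map
  between normed spaces with invertible derivative at a point is a local diffeomorphism there;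
* `Literature.Topology.FourManifolds.fst_prod_eq_skewProd` — a derivative `(fst, f')` whose
  `E`-block `B` is invertible is Mathlib's block-triangular `ContinuousLinearEquiv.skewProd`;
* `Literature.Topology.FourManifolds.isLocalDiffeomorphAt_graph` — **the parametric inverse
  function theorem**: if `f : P × E → F` is `C^n` near `q` and `x ↦ f (q.1, x)` has an invertible
  derivative `B` at `q.2`, then `(p, x) ↦ (p, f (p, x))` is a `C^n` local diffeomorphism at `q`;
  `Literature.Topology.FourManifolds.isLocalDiffeomorphAt_graph_real` — the case `E = F = ℝ`
  (nonvanishing partial derivative);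
* `Literature.Topology.FourManifolds.hasFDerivAt_of_partials` (the derivative of a differentiable
  map of two real variables is the pair `Literature.Topology.FourManifolds.pair2Map` of its partial
  derivatives) and `Literature.Topology.FourManifolds.pair2Equiv` (two plane vectors with nonzero
  determinant give `ℝ × ℝ ≃L ℂ`, inverse by Cramer's rule) — to feed planar tube maps to the above.

Everything is proved; no named facts.

## References

* J. M. Lee, *Introduction to Smooth Manifolds*, 2nd ed., GTM 218 (2013), Thm. 4.5, Thm. C.40.
  [LeeSmoothManifolds2013]
* R. E. Gompf, *More Cappell–Shaneson spheres are standard*, Algebr. Geom. Topol. 10 (2010)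
  1665–1681, Lemma 2.2. [GompfAGT2010]
-/

noncomputable section

open scoped Manifold ContDiff Topology
open Set Function Filter

namespace Literature.Topology.FourManifolds

section NormedSpace

variable {E : Type*} [NormedAddCommGroup E] [NormedSpace ℝ E] [CompleteSpace E]
  {F : Type*} [NormedAddCommGroup F] [NormedSpace ℝ F]
  {n : WithTop ℕ∞}

/-- **Inverse function theorem between normed spaces, `IsLocalDiffeomorphAt` form**: a map which
is `C^n` (`1 ≤ n`) on an open set containing `a` and has an invertible derivative at `a` is a
`C^n` local diffeomorphism at `a`. [cite: LeeSmoothManifolds2013, Thm. 4.5] -/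
theorem isLocalDiffeomorphAt_of_hasFDerivAt_equiv {f : E → F} {a : E} {U : Set E} (hU : IsOpen U)
    (haU : a ∈ U) (hf : ContDiffOn ℝ n f U) (hn : 1 ≤ n) (L : E ≃L[ℝ] F)
    (hL : HasFDerivAt f (L : E →L[ℝ] F) a) :
    IsLocalDiffeomorphAt 𝓘(ℝ, E) 𝓘(ℝ, F) n f a := by
  refine isLocalDiffeomorphAt_of_mfderiv hU haU (contMDiffOn_iff_contDiffOn.2 hf) hn L ?_
  rw [mfderiv_eq_fderiv, hL.fderiv]

/-- Global version: a `C^n` map with invertible derivative at `a`. [cite: LeeSmoothManifolds2013, Thm. 4.5] -/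
theorem isLocalDiffeomorphAt_of_hasFDerivAt_equiv' {f : E → F} {a : E} (hf : ContDiff ℝ n f)
    (hn : 1 ≤ n) (L : E ≃L[ℝ] F) (hL : HasFDerivAt f (L : E →L[ℝ] F) a) :
    IsLocalDiffeomorphAt 𝓘(ℝ, E) 𝓘(ℝ, F) n f a :=
  isLocalDiffeomorphAt_of_hasFDerivAt_equiv isOpen_univ (mem_univ a) hf.contDiffOn hn L hL

end NormedSpace

/-! ### The block-triangular derivative -/

section Block

variable {P : Type*} [NormedAddCommGroup P] [NormedSpace ℝ P]
  {E : Type*} [NormedAddCommGroup E] [NormedSpace ℝ E]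
  {F : Type*} [NormedAddCommGroup F] [NormedSpace ℝ F]

/-- **A derivative whose `E`-block is invertible is block-triangular**: if `f' : P × E →L F` has
`f' ∘ inr = B` invertible, then `(fst, f')` is Mathlib's skew product
`(refl P).skewProd B (f' ∘ inl) : (p, x) ↦ (p, B x + f' (p, 0))`. [folklore] -/
theorem fst_prod_eq_skewProd (f' : P × E →L[ℝ] F) (B : E ≃L[ℝ] F)
    (hB : f'.comp (ContinuousLinearMap.inr ℝ P E) = (B : E →L[ℝ] F)) :
    (ContinuousLinearMap.fst ℝ P E).prod f' =
      ((ContinuousLinearEquiv.refl ℝ P).skewProd B (f'.comp (ContinuousLinearMap.inl ℝ P E)) :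
        (P × E) →L[ℝ] (P × F)) := by
  refine ContinuousLinearMap.ext fun q ↦ Prod.ext rfl ?_
  obtain ⟨p, x⟩ := q
  have h1 : f' (p, x) = f' (p, 0) + f' (0, x) := by
    rw [← map_add, Prod.mk_add_mk, add_zero, zero_add]
  have h2 : f' (0, x) = B x := by
    have := congrArg (fun T : E →L[ℝ] F ↦ T x) hB
    simpa using this
  show f' (p, x) = ((ContinuousLinearEquiv.refl ℝ P).skewProd B (f'.comp (ContinuousLinearMap.inl ℝ P E)) (p, x)).2
  rw [ContinuousLinearEquiv.skewProd_apply]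
  simp [h1, h2, add_comm]

end Block

/-! ### The parametric inverse function theorem -/

section Graph

variable {P : Type*} [NormedAddCommGroup P] [NormedSpace ℝ P] [CompleteSpace P]
  {E : Type*} [NormedAddCommGroup E] [NormedSpace ℝ E] [CompleteSpace E]
  {F : Type*} [NormedAddCommGroup F] [NormedSpace ℝ F]
  {n : WithTop ℕ∞}

/-- **Parametric inverse function theorem.** Let `f : P × E → F` be `C^n` (`1 ≤ n`) on an open
set `U ∋ q` and suppose the partial map `x ↦ f (q.1, x)` has an invertible derivative
`B : E ≃L F` at `q.2`. Then `(p, x) ↦ (p, f (p, x))` is a `C^n` local diffeomorphism at `q`: its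
derivative is the block-triangular equivalence `(refl P).skewProd B (∂ₚf)`. [cite: LeeSmoothManifolds2013, Thm. C.40 (proof: apply Thm. 4.5 to (x, y) ↦ (x, Φ(x, y)))] -/
theorem isLocalDiffeomorphAt_graph {f : P × E → F} {q : P × E} {U : Set (P × E)} (hU : IsOpen U)
    (hqU : q ∈ U) (hf : ContDiffOn ℝ n f U) (hn : 1 ≤ n) (B : E ≃L[ℝ] F)
    (hB : HasFDerivAt (fun x ↦ f (q.1, x)) (B : E →L[ℝ] F) q.2) :
    IsLocalDiffeomorphAt 𝓘(ℝ, P × E) 𝓘(ℝ, P × F) n (fun q ↦ (q.1, f q)) q := by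
  have hn0 : n ≠ 0 := by
    rintro rfl
    exact not_lt.2 hn zero_lt_one
  -- the derivative of `f` at `q` and its `E`-block
  have hfq : ContDiffAt ℝ n f q := hf.contDiffAt (hU.mem_nhds hqU)
  have hd : HasFDerivAt f (fderiv ℝ f q) q := (hfq.differentiableAt hn0).hasFDerivAt
  set f' := fderiv ℝ f q with hf'
  have hpart : HasFDerivAt (fun x ↦ f (q.1, x)) (f'.comp (ContinuousLinearMap.inr ℝ P E)) q.2 := by
    have h1 : HasFDerivAt (fun x : E ↦ (q.1, x)) (ContinuousLinearMap.inr ℝ P E) q.2 :=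
      (hasFDerivAt_const q.1 q.2).prodMk (hasFDerivAt_id q.2)
    have h2 : HasFDerivAt f f' (q.1, q.2) := by simpa using hd
    exact h2.comp q.2 h1
  have hBe : f'.comp (ContinuousLinearMap.inr ℝ P E) = (B : E →L[ℝ] F) := hpart.unique hB
  -- the derivative of the graph map is the skew product
  have hG : HasFDerivAt (fun q : P × E ↦ (q.1, f q))
      (((ContinuousLinearEquiv.refl ℝ P).skewProd B (f'.comp (ContinuousLinearMap.inl ℝ P E)) :
        (P × E) ≃L[ℝ] (P × F)) : (P × E) →L[ℝ] (P × F)) q := by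
    rw [← fst_prod_eq_skewProd f' B hBe]
    exact hasFDerivAt_fst.prodMk hd
  have hGs : ContDiffOn ℝ n (fun q : P × E ↦ (q.1, f q)) U := contDiffOn_fst.prodMk hf
  exact isLocalDiffeomorphAt_of_hasFDerivAt_equiv hU hqU hGs hn _ hG

/-- Global version of `isLocalDiffeomorphAt_graph`. [cite: LeeSmoothManifolds2013, Thm. C.40] -/
theorem isLocalDiffeomorphAt_graph' {f : P × E → F} {q : P × E} (hf : ContDiff ℝ n f) (hn : 1 ≤ n)
    (B : E ≃L[ℝ] F) (hB : HasFDerivAt (fun x ↦ f (q.1, x)) (B : E →L[ℝ] F) q.2) :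
    IsLocalDiffeomorphAt 𝓘(ℝ, P × E) 𝓘(ℝ, P × F) n (fun q ↦ (q.1, f q)) q :=
  isLocalDiffeomorphAt_graph isOpen_univ (mem_univ q) hf.contDiffOn hn B hB

/-- **Parametric inverse function theorem, one real unknown**: if `f : P × ℝ → ℝ` is `C^n`
(`1 ≤ n`) on an open `U ∋ q` and `∂ₓ f (q) = c ≠ 0`, then `(p, x) ↦ (p, f (p, x))` is a `C^n`
local diffeomorphism at `q`. [cite: LeeSmoothManifolds2013, Thm. C.40] -/
theorem isLocalDiffeomorphAt_graph_real {f : P × ℝ → ℝ} {q : P × ℝ} {U : Set (P × ℝ)}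
    (hU : IsOpen U) (hqU : q ∈ U) (hf : ContDiffOn ℝ n f U) (hn : 1 ≤ n) {c : ℝ} (hc : c ≠ 0)
    (hd : HasDerivAt (fun x ↦ f (q.1, x)) c q.2) :
    IsLocalDiffeomorphAt 𝓘(ℝ, P × ℝ) 𝓘(ℝ, P × ℝ) n (fun q ↦ (q.1, f q)) q := by
  refine isLocalDiffeomorphAt_graph hU hqU hf hn (ContinuousLinearEquiv.unitsEquivAut ℝ (Units.mk0 c hc)) ?_
  have h := hd.hasFDerivAt
  refine h.congr_fderiv ?_
  ext
  simp

end Graph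

/-! ### Planar derivatives from partial derivatives -/

section Planar

variable {F : Type*} [NormedAddCommGroup F] [NormedSpace ℝ F]

/-- The linear map `(h, k) ↦ h • u + k • v` of `ℝ × ℝ → F`. [folklore] -/
def pair2Map (u v : F) : ℝ × ℝ →L[ℝ] F :=
  (ContinuousLinearMap.fst ℝ ℝ ℝ).smulRight u + (ContinuousLinearMap.snd ℝ ℝ ℝ).smulRight v

/-- The value of `pair2Map`. [folklore] -/
@[simp] theorem pair2Map_apply (u v : F) (q : ℝ × ℝ) : pair2Map u v q = q.1 • u + q.2 • v := rfl

/-- **The Fréchet derivative of a differentiable map of two real variables is the pair of its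
partial derivatives.** [folklore] -/
theorem hasFDerivAt_of_partials {f : ℝ × ℝ → F} {p : ℝ × ℝ} (hf : DifferentiableAt ℝ f p) {u v : F}
    (hu : HasDerivAt (fun a ↦ f (a, p.2)) u p.1) (hv : HasDerivAt (fun b ↦ f (p.1, b)) v p.2) :
    HasFDerivAt f (pair2Map u v) p := by
  have hd := hf.hasFDerivAt
  -- the partial derivatives of `f` are the values of `fderiv f p` on `(1, 0)` and `(0, 1)`
  have h1 : HasDerivAt (fun a ↦ f (a, p.2)) (fderiv ℝ f p (1, 0)) p.1 := by
    have hc : HasDerivAt (fun a : ℝ ↦ (a, p.2)) (1, 0) p.1 := (hasDerivAt_id p.1).prodMk (hasDerivAt_const p.1 p.2)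
    exact hd.comp_hasDerivAt p.1 hc
  have h2 : HasDerivAt (fun b ↦ f (p.1, b)) (fderiv ℝ f p (0, 1)) p.2 := by
    have hc : HasDerivAt (fun b : ℝ ↦ (p.1, b)) (0, 1) p.2 := (hasDerivAt_const p.2 p.1).prodMk (hasDerivAt_id p.2)
    exact hd.comp_hasDerivAt p.2 hc
  have hu' : fderiv ℝ f p (1, 0) = u := h1.unique hu
  have hv' : fderiv ℝ f p (0, 1) = v := h2.unique hv
  refine hd.congr_fderiv (ContinuousLinearMap.ext fun q ↦ ?_)
  have hq : q = q.1 • ((1 : ℝ), (0 : ℝ)) + q.2 • ((0 : ℝ), (1 : ℝ)) := by ext <;> simp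
  conv_lhs => rw [hq]
  rw [map_add, map_smul, map_smul, hu', hv', pair2Map_apply]

/-- **A pair of plane vectors with nonzero determinant spans**: `(h, k) ↦ h u + k v` as a
continuous linear equivalence `ℝ × ℝ ≃L ℂ` (inverse by Cramer's rule). [folklore] -/
def pair2Equiv (u v : ℂ) (hD : u.re * v.im - u.im * v.re ≠ 0) : (ℝ × ℝ) ≃L[ℝ] ℂ :=
  ContinuousLinearEquiv.equivOfInverse (pair2Map u v)
    ((u.re * v.im - u.im * v.re)⁻¹ •
      ((Complex.reCLM.smulRight (v.im, -u.im) : ℂ →L[ℝ] ℝ × ℝ) + Complex.imCLM.smulRight (-v.re, u.re)))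
    (fun q ↦ by
      obtain ⟨h, k⟩ := q
      simp only [pair2Map_apply]
      ext
      · simp
        field_simp
        ring
      · simp
        field_simp
        ring)
    (fun z ↦ by
      apply Complex.ext
      · simp only [pair2Map_apply, FunLike.coe_smul, Pi.smul_apply, add_apply, ContinuousLinearMap.smulRight_apply,
          Complex.reCLM_apply, Complex.imCLM_apply, Prod.smul_mk, Prod.mk_add_mk, smul_eq_mul, Complex.add_re,
          Complex.smul_re]
        field_simp
        ring
      · simp only [pair2Map_apply, FunLike.coe_smul, Pi.smul_apply, add_apply, ContinuousLinearMap.smulRight_apply,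
          Complex.reCLM_apply, Complex.imCLM_apply, Prod.smul_mk, Prod.mk_add_mk, smul_eq_mul, Complex.add_im,
          Complex.smul_im]
        field_simp
        ring)

/-- The underlying map of `pair2Equiv`. [folklore] -/
@[simp] theorem coe_pair2Equiv (u v : ℂ) (hD : u.re * v.im - u.im * v.re ≠ 0) :
    (pair2Equiv u v hD : ℝ × ℝ →L[ℝ] ℂ) = pair2Map u v := rfl

end Planar

end Literature.Topology.FourManifolds
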